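import Summits.Ventures.CertifiedManyBodySolver.Observables.PairBoxWordD4
import HarnessLib

/-!
# The pair-ODLRO ceiling with POSITIVE-SEMIDEFINITE TAPS: every kernel `K_Q(ξ) = Σ_{i,j} Q_{ij} e^{i(p_j−p_i)·ξ}`
# with `Q ⪰ 0` turns certified pair cells into one ceiling `(Σ_{i,j} Q_{ij}) · m² ≤ Σ_{i,j} Q_{ij} Re ω(Φ_{p_i}† Φ_{p_j})`

HONEST FRAMING: first certified bounds on pairing observables; not a superconductivity verdict; every
number certified (two lineages + referee) or labelled float. Crew hubbard-obs (D-0042), seat hubbard-obs-p1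
(`prover-hubbard-obs-p1-g2-0`), lead ruling (af2). Theorem-only apart from ONE auxiliary definition
(`pairKernelWord`, the objective WORD of a kernel certificate, so that the rows of `Rows/DopedTLCorr*.lean`
can name it); zero compute; no named fact; no `sorry`.

`Observables/PairODLROCeilingTL.lean` proved the BOX ceiling `|B|² · braggWeight μ ![0] ≤ Σ_{x,y∈B} Re C(y−x)`
(kernel `|Σ_{x∈B} e^{ix·ξ}|²`, i.e. all taps equal to `1`). Here the taps are an arbitrary real matrix
`Q : ι → ι → ℝ` that is positive semidefinite as a quadratic form on the finite index set `T`
(`∀ c, 0 ≤ Σ_{i,j∈T} Q i j c_i c_j`), attached to lattice points by ANY placement `p : ι → ℤᵈ`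
(repetitions allowed):

* §1 `kernel_mul_braggWeight_zero_le` (any `d`, any finite measure `μ` representing `C : ℤᵈ → ℂ`):
  **`(Σ_{i,j∈T} Q i j) · braggWeight μ ![0] ≤ Σ_{i,j∈T} Q i j · Re C(p j − p i)`**. Kernel:
  `K(ξ) = Σ Q i j cos((p j − p i)·ξ) = cᵀQc + sᵀQs ≥ 0` with `c_i = cos(p_i·ξ)`, `s_i = sin(p_i·ξ)`
  (`sum_sum_mul_cos_sub_nonneg`), `K = Σ Q i j` on `2πℤᵈ`. Rank one (`Q = q qᵀ`, no side condition):
  `(Σ_{i∈T} q i)² · braggWeight μ ![0] ≤ Σ_{i,j} q i q j Re C(p j − p i)` (`sq_sum_mul_braggWeight_zero_le`);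
  `q ≡ 1`, `p = id` is the box ceiling. A Gram presentation `Q i j = Σ_k w_k v_k i v_k j`, `w_k ≥ 0`,
  discharges the side condition (`kernelTaps_nonneg_of_gram`).
* §2 for a translation-invariant `ω : InfVolFermionState 2` and every `μ` representing its pair two-point
  function: **`(Σ Q) · braggWeight μ ![0] ≤ Σ_{i,j∈T} Q i j · Re ω.pairCorr S g (p i) (p j)`**
  (`kernel_mul_braggWeight_le_sum_re_pairCorr`, d-wave `…_dWavePairCorr`).
* §3 the certificate side: the KERNEL PAIR WORD `pairKernelWord S g B Q = Σ_{x,y∈B} Q x y • Γ(Φ_x)† Γ(Φ_y)`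
  (`Q : Site 2 → Site 2 → ℚ`, exact data), `ω(pairKernelWord) = Σ_{x,y∈B} Q x y · ω.pairCorr S g x y`
  (`expect_pairKernelWord`) and the row ⇒ ceiling edge: an UPPER row
  `SquareTTPrimeCorrUpperRow tp U n u fu Λ_B (pairKernelWord S g B Q)` with `Q ⪰ 0` on `B` gives
  `(Σ_{x,y∈B} Q x y) · braggWeight μ ![0] ≤ fu` (`kernel_mul_braggWeight_le_of_pairKernel_upperRow`, normalised
  and M3′ d-wave forms). The `D₄` transport and the ORBIT-row edge (leg-J certificates, no `D₄`-invariance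
  assumed on `ω`, `B` or `Q`) are in the companion `Observables/PairKernelWordD4.lean`.

WHY (PAIRCORR-SDP.md §6, the cell's one honest lever at fixed level): for a fixed certified relaxation the
best box bound is `max_y Σ_{x,y∈B} P(y)/|B|²` (Bartlett), the best PSD-kernel bound is
`min_{Q⪰0} max_y ⟨Q, P(y)⟩/⟨Q, J⟩` — never worse, strictly better whenever the certified pair cells are not
flat across displacements; the taps are chosen BEFORE certification (float pre-solve), the certificate is
one more linear objective on the program of record. A ceiling says nothing about the presence of pairing.

References: Katznelson, *An Introduction to Harmonic Analysis*, I.7 (Herglotz); Grafakos, *Classical Fourier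
Analysis* (2008) Prop. 3.1.7 (Fejér as the `q ≡ 1` autocorrelation); Capon, Proc. IEEE 57 (1969) 1408
(minimum-variance windows); Scalapino, Phys. Rep. 250 (1995) 329, §2 eq. (2.3)–(2.4); Sewell, J. Math.
Phys. 11 (1970) 1868, §4.
-/

noncomputable section

open MeasureTheory Complex Filter Topology
open scoped Real BigOperators

namespace Summit.Ventures.CertifiedManyBodySolver.Observables

/-! ## §1  The `Q = 0` kernel ceiling with positive-semidefinite taps -/

section General

variable {d : ℕ}

/-- `Σ_{i,j} Q i j cos(θ_j − θ_i) = Σ_{i,j} Q i j cos θ_i cos θ_j + Σ_{i,j} Q i j sin θ_i sin θ_j`. -/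
theorem sum_sum_mul_cos_sub_eq {ι : Type*} (T : Finset ι) (Q : ι → ι → ℝ) (θ : ι → ℝ) :
    ∑ i ∈ T, ∑ j ∈ T, Q i j * Real.cos (θ j - θ i) =
      ∑ i ∈ T, ∑ j ∈ T, Q i j * Real.cos (θ i) * Real.cos (θ j) +
        ∑ i ∈ T, ∑ j ∈ T, Q i j * Real.sin (θ i) * Real.sin (θ j) := by
  rw [← Finset.sum_add_distrib]
  refine Finset.sum_congr rfl fun i _ => ?_
  rw [← Finset.sum_add_distrib]
  refine Finset.sum_congr rfl fun j _ => ?_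
  rw [Real.cos_sub]; ring

/-- **Positive-semidefinite taps give a nonnegative kernel**: if `Σ_{i,j∈T} Q i j c_i c_j ≥ 0` for every real
`c`, then `0 ≤ Σ_{i,j∈T} Q i j cos(θ_j − θ_i)` for every family of phases `θ`. -/
theorem sum_sum_mul_cos_sub_nonneg {ι : Type*} (T : Finset ι) (Q : ι → ι → ℝ)
    (hQ : ∀ c : ι → ℝ, 0 ≤ ∑ i ∈ T, ∑ j ∈ T, Q i j * c i * c j) (θ : ι → ℝ) :
    0 ≤ ∑ i ∈ T, ∑ j ∈ T, Q i j * Real.cos (θ j - θ i) := by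
  rw [sum_sum_mul_cos_sub_eq]
  exact add_nonneg (hQ _) (hQ _)

/-- Rank-one taps `Q i j = q i * q j` are positive semidefinite: `Σ_{i,j} q i q j c_i c_j = (Σ_i q i c_i)² ≥ 0`. -/
theorem kernelTaps_nonneg_of_rankOne {ι : Type*} (T : Finset ι) (q : ι → ℝ) (c : ι → ℝ) :
    0 ≤ ∑ i ∈ T, ∑ j ∈ T, q i * q j * c i * c j := by
  have h : ∑ i ∈ T, ∑ j ∈ T, q i * q j * c i * c j = (∑ i ∈ T, q i * c i) * (∑ j ∈ T, q j * c j) := by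
    rw [Finset.sum_mul_sum]
    refine Finset.sum_congr rfl fun i _ => Finset.sum_congr rfl fun j _ => by ring
  rw [h]
  exact mul_self_nonneg _

/-- **A Gram presentation discharges the side condition**: taps `Q i j = Σ_{k∈K} w k · v k i · v k j` with
weights `w k ≥ 0` (an exact `LDLᵀ` of the rounded optimal kernel, say) satisfy `Σ_{i,j} Q i j c_i c_j ≥ 0`. -/
theorem kernelTaps_nonneg_of_gram {ι κ : Type*} (T : Finset ι) (K : Finset κ) (w : κ → ℝ) (v : κ → ι → ℝ)
    (hw : ∀ k ∈ K, 0 ≤ w k) (Q : ι → ι → ℝ) (hQ : ∀ i ∈ T, ∀ j ∈ T, Q i j = ∑ k ∈ K, w k * v k i * v k j)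
    (c : ι → ℝ) : 0 ≤ ∑ i ∈ T, ∑ j ∈ T, Q i j * c i * c j := by
  have h : ∑ i ∈ T, ∑ j ∈ T, Q i j * c i * c j =
      ∑ k ∈ K, w k * ∑ i ∈ T, ∑ j ∈ T, v k i * v k j * c i * c j := by
    calc ∑ i ∈ T, ∑ j ∈ T, Q i j * c i * c j
        = ∑ i ∈ T, ∑ j ∈ T, ∑ k ∈ K, w k * (v k i * v k j * c i * c j) := by
          refine Finset.sum_congr rfl fun i hi => Finset.sum_congr rfl fun j hj => ?_
          rw [hQ i hi j hj, Finset.sum_mul, Finset.sum_mul]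
          exact Finset.sum_congr rfl fun k _ => by ring
      _ = ∑ k ∈ K, ∑ i ∈ T, ∑ j ∈ T, w k * (v k i * v k j * c i * c j) := by
          have h1 : ∀ i ∈ T, ∑ j ∈ T, ∑ k ∈ K, w k * (v k i * v k j * c i * c j) =
              ∑ k ∈ K, ∑ j ∈ T, w k * (v k i * v k j * c i * c j) := fun i _ => Finset.sum_comm
          rw [Finset.sum_congr rfl h1, Finset.sum_comm]
      _ = ∑ k ∈ K, w k * ∑ i ∈ T, ∑ j ∈ T, v k i * v k j * c i * c j := by
          refine Finset.sum_congr rfl fun k _ => ?_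
          rw [Finset.mul_sum]
          exact Finset.sum_congr rfl fun i _ => by rw [Finset.mul_sum]
  rw [h]
  exact Finset.sum_nonneg fun k hk => mul_nonneg (hw k hk) (kernelTaps_nonneg_of_rankOne T (v k) c)

variable {C : (Fin d → ℤ) → ℂ} (μ : Measure (EuclideanSpace ℝ (Fin d))) [IsFiniteMeasure μ]

/-- **The `Q = 0` ceiling with positive-semidefinite taps.** For a finite measure `μ` on `ℝᵈ` representing
`C : ℤᵈ → ℂ` (`∫ exp (i r·ξ) dμ = C r`), a finite index set `T`, a placement `p : ι → ℤᵈ` and real taps `Q`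
positive semidefinite on `T`:
`(Σ_{i,j∈T} Q i j) · braggWeight μ ![0] ≤ Σ_{i∈T} Σ_{j∈T} Q i j · Re C(p j − p i)`.
Proof: `K(ξ) = Σ_{i,j} Q i j cos((p j − p i)·ξ) ≥ 0` (`sum_sum_mul_cos_sub_nonneg`) equals `Σ Q i j` on `2πℤᵈ`,
so `(Σ Q) μ(2πℤᵈ) = ∫_{2πℤᵈ} K ≤ ∫ K = Σ Q i j Re C(p j − p i)`. [cite: Katznelson2004, I.7 (Herglotz)] -/
theorem kernel_mul_braggWeight_zero_le
    (hμ : ∀ r : Fin d → ℤ, ∫ ξ, exp ((∑ i, (r i : ℝ) * ξ i : ℝ) * I) ∂μ = C r)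
    {ι : Type*} (T : Finset ι) (p : ι → (Fin d → ℤ)) (Q : ι → ι → ℝ)
    (hQ : ∀ c : ι → ℝ, 0 ≤ ∑ i ∈ T, ∑ j ∈ T, Q i j * c i * c j) :
    (∑ i ∈ T, ∑ j ∈ T, Q i j) * braggWeight μ ![(0 : Fin d → ℝ)] ≤
      ∑ i ∈ T, ∑ j ∈ T, Q i j * (C (p j - p i)).re := by
  set A : Set (EuclideanSpace ℝ (Fin d)) := ⋃ j : Fin 1, braggSet ((![(0 : Fin d → ℝ)]) j) with hA
  set K : EuclideanSpace ℝ (Fin d) → ℝ :=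
    fun ξ => ∑ i ∈ T, ∑ j ∈ T, Q i j * Real.cos (∑ k, ((p j - p i) k : ℝ) * ξ k) with hKdef
  -- the phases `θ_i = p_i·ξ`
  have hθ : ∀ (ξ : EuclideanSpace ℝ (Fin d)) (x y : Fin d → ℤ),
      (∑ k, ((y - x) k : ℝ) * ξ k) = (∑ k, (y k : ℝ) * ξ k) - ∑ k, (x k : ℝ) * ξ k := by
    intro ξ x y
    rw [← Finset.sum_sub_distrib]
    refine Finset.sum_congr rfl fun k _ => ?_
    rw [Pi.sub_apply]; push_cast; ring
  have hKnn : ∀ ξ, 0 ≤ K ξ := by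
    intro ξ
    rw [hKdef]; dsimp only
    simp_rw [hθ ξ]
    exact sum_sum_mul_cos_sub_nonneg T Q hQ (fun i : ι => ∑ k, (p i k : ℝ) * ξ k)
  have hKcont : Continuous K := by rw [hKdef]; fun_prop
  have hKbd : ∀ ξ, ‖K ξ‖ ≤ ∑ i ∈ T, ∑ j ∈ T, |Q i j| := by
    intro ξ
    rw [hKdef, Real.norm_eq_abs]; dsimp only
    refine (Finset.abs_sum_le_sum_abs _ _).trans ?_
    refine Finset.sum_le_sum fun i _ => (Finset.abs_sum_le_sum_abs _ _).trans ?_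
    refine Finset.sum_le_sum fun j _ => ?_
    rw [abs_mul]
    exact mul_le_of_le_one_right (abs_nonneg _) (Real.abs_cos_le_one _)
  have hKint : Integrable K μ :=
    Integrable.mono' (integrable_const _) hKcont.aestronglyMeasurable (ae_of_all _ hKbd)
  -- on `2πℤᵈ` every cosine is `1`
  have hKA : ∀ ξ ∈ A, K ξ = ∑ i ∈ T, ∑ j ∈ T, Q i j := by
    intro ξ hξ
    rw [hA, Set.mem_iUnion] at hξ
    obtain ⟨j, hj⟩ := hξ
    obtain rfl : j = 0 := Subsingleton.elim _ _
    rw [Matrix.cons_val_zero] at hj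
    obtain ⟨mv, hm⟩ := hj
    rw [hKdef]; dsimp only
    have hcos : ∀ x y : Fin d → ℤ, Real.cos (∑ k, ((y - x) k : ℝ) * ξ k) = 1 := by
      intro x y
      have : (∑ k, ((y - x) k : ℝ) * ξ k) = ((∑ k, (y - x) k * mv k : ℤ) : ℝ) * (2 * π) := by
        push_cast
        rw [Finset.sum_mul]
        exact Finset.sum_congr rfl fun k _ => by rw [hm k, Pi.zero_apply]; ring
      rw [this, Real.cos_int_mul_two_pi]
    simp_rw [hcos, mul_one]
  have hAmeas : MeasurableSet A := MeasurableSet.iUnion fun j => measurableSet_braggSet _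
  -- each cosine is integrable; the integral of `K` is the weighted window sum
  have hcosInt : ∀ x y : Fin d → ℤ,
      Integrable (fun ξ : EuclideanSpace ℝ (Fin d) => Real.cos (∑ k, ((y - x) k : ℝ) * ξ k)) μ := by
    intro x y
    refine Integrable.mono' (integrable_const (1 : ℝ)) (by fun_prop) (ae_of_all _ fun ξ => ?_)
    rw [Real.norm_eq_abs]
    exact Real.abs_cos_le_one _
  have hKI : ∫ ξ, K ξ ∂μ = ∑ i ∈ T, ∑ j ∈ T, Q i j * (C (p j - p i)).re := by
    rw [hKdef]; dsimp only
    rw [integral_finsetSum _ fun i _ => integrable_finsetSum _ fun j _ => (hcosInt (p i) (p j)).const_mul _]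
    refine Finset.sum_congr rfl fun i _ => ?_
    rw [integral_finsetSum _ fun j _ => (hcosInt (p i) (p j)).const_mul _]
    refine Finset.sum_congr rfl fun j _ => ?_
    rw [integral_const_mul, integral_cos_eq_re μ hμ (p j - p i)]
  unfold braggWeight
  calc (∑ i ∈ T, ∑ j ∈ T, Q i j) * (μ A).toReal
      = ∫ _ξ in A, (∑ i ∈ T, ∑ j ∈ T, Q i j) ∂μ := by
        rw [setIntegral_const, Measure.real, smul_eq_mul, mul_comm]
    _ = ∫ ξ in A, K ξ ∂μ := setIntegral_congr_fun hAmeas fun ξ hξ => (hKA ξ hξ).symm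
    _ ≤ ∫ ξ, K ξ ∂μ := setIntegral_le_integral hKint (ae_of_all _ hKnn)
    _ = ∑ i ∈ T, ∑ j ∈ T, Q i j * (C (p j - p i)).re := hKI

/-- **Rank-one taps (no side condition).** For real weights `q` and any placement `p`:
`(Σ_{i∈T} q i)² · braggWeight μ ![0] ≤ Σ_{i,j∈T} q i · q j · Re C(p j − p i)` — the TAPERED-window ceiling;
`q ≡ 1`, `p = id` is the box ceiling `sq_card_mul_braggWeight_zero_le`. [cite: Katznelson2004, I.7 (Herglotz)] -/
theorem sq_sum_mul_braggWeight_zero_le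
    (hμ : ∀ r : Fin d → ℤ, ∫ ξ, exp ((∑ i, (r i : ℝ) * ξ i : ℝ) * I) ∂μ = C r)
    {ι : Type*} (T : Finset ι) (p : ι → (Fin d → ℤ)) (q : ι → ℝ) :
    (∑ i ∈ T, q i) ^ 2 * braggWeight μ ![(0 : Fin d → ℝ)] ≤
      ∑ i ∈ T, ∑ j ∈ T, q i * q j * (C (p j - p i)).re := by
  have h := kernel_mul_braggWeight_zero_le μ hμ T p (fun i j => q i * q j)
    (fun c => kernelTaps_nonneg_of_rankOne T q c)
  have hsq : ∑ i ∈ T, ∑ j ∈ T, q i * q j = (∑ i ∈ T, q i) ^ 2 := by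
    rw [sq, Finset.sum_mul_sum]
  rwa [hsq] at h

/-- Consistency: unit taps on `B` itself give back the box ceiling of `PairODLROCeilingTL`. -/
example (hμ : ∀ r : Fin d → ℤ, ∫ ξ, exp ((∑ i, (r i : ℝ) * ξ i : ℝ) * I) ∂μ = C r)
    (B : Finset (Fin d → ℤ)) :
    ((B.card : ℝ)) ^ 2 * braggWeight μ ![(0 : Fin d → ℝ)] ≤ ∑ x ∈ B, ∑ y ∈ B, (C (y - x)).re := by
  have h := sq_sum_mul_braggWeight_zero_le μ hμ B id (fun _ => (1 : ℝ))
  simp only [Finset.sum_const, nsmul_eq_mul, mul_one, one_mul, id] at h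
  exact h

end General

/-! ## §2  The pair two-point function of a translation-invariant state -/

section Pair

open Matrix Literature.MathematicalPhysics.QuantumLattice Literature.Probability.LatticeModels

variable (S : Finset (Site 2)) (g : Site 2 → ℝ)

/-- **The kernel pair-ODLRO ceiling.** For a translation-invariant `ω`, EVERY finite measure `μ`
representing its pair two-point function `r ↦ ω.pairCorr S g 0 r`, every finite index set `T`, placement
`p : ι → ℤ²` and real taps `Q` positive semidefinite on `T`:
`(Σ_{i,j∈T} Q i j) · braggWeight μ ![0] ≤ Σ_{i,j∈T} Q i j · Re ω.pairCorr S g (p i) (p j)`.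
A certified UPPER bound on the right-hand side (one SDP objective) is a certified ceiling on the pair ODLRO
density. [cite: Sewell1970, §4 (Thm. 4.3)] -/
theorem kernel_mul_braggWeight_le_sum_re_pairCorr {ω : InfVolFermionState 2} (hω : ω.IsTranslationInvariant)
    (μ : Measure (EuclideanSpace ℝ (Fin 2))) [IsFiniteMeasure μ]
    (hμ : ∀ r : Site 2, ∫ ξ, exp ((∑ i, (r i : ℝ) * ξ i : ℝ) * I) ∂μ = ω.pairCorr S g 0 r)
    {ι : Type*} (T : Finset ι) (p : ι → Site 2) (Q : ι → ι → ℝ)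
    (hQ : ∀ c : ι → ℝ, 0 ≤ ∑ i ∈ T, ∑ j ∈ T, Q i j * c i * c j) :
    (∑ i ∈ T, ∑ j ∈ T, Q i j) * braggWeight μ ![(0 : Fin 2 → ℝ)] ≤
      ∑ i ∈ T, ∑ j ∈ T, Q i j * (ω.pairCorr S g (p i) (p j)).re := by
  have h := kernel_mul_braggWeight_zero_le μ hμ T p Q hQ
  simp_rw [pairCorr_zero_sub S g hω] at h
  exact h

/-- The `d`-wave form: `(Σ Q) · braggWeight μ ![0] ≤ Σ_{i,j∈T} Q i j · Re ω.dWavePairCorr (p i) (p j)` for every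
measure representing `r ↦ ω.dWavePairCorr 0 r`. -/
theorem kernel_mul_braggWeight_le_sum_re_dWavePairCorr {ω : InfVolFermionState 2}
    (hω : ω.IsTranslationInvariant) (μ : Measure (EuclideanSpace ℝ (Fin 2))) [IsFiniteMeasure μ]
    (hμ : ∀ r : Site 2, ∫ ξ, exp ((∑ i, (r i : ℝ) * ξ i : ℝ) * I) ∂μ = ω.dWavePairCorr 0 r)
    {ι : Type*} (T : Finset ι) (p : ι → Site 2) (Q : ι → ι → ℝ)
    (hQ : ∀ c : ι → ℝ, 0 ≤ ∑ i ∈ T, ∑ j ∈ T, Q i j * c i * c j) :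
    (∑ i ∈ T, ∑ j ∈ T, Q i j) * braggWeight μ ![(0 : Fin 2 → ℝ)] ≤
      ∑ i ∈ T, ∑ j ∈ T, Q i j * (ω.dWavePairCorr (p i) (p j)).re :=
  kernel_mul_braggWeight_le_sum_re_pairCorr (insert 0 unitSteps) dWaveFormFactor hω μ hμ T p Q hQ

/-- Rank-one (tapered window) form, no side condition: `(Σ_{i∈T} q i)² · braggWeight μ ![0] ≤
Σ_{i,j∈T} q i q j · Re ω.pairCorr S g (p i) (p j)`. -/
theorem sq_sum_mul_braggWeight_le_sum_re_pairCorr {ω : InfVolFermionState 2} (hω : ω.IsTranslationInvariant)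
    (μ : Measure (EuclideanSpace ℝ (Fin 2))) [IsFiniteMeasure μ]
    (hμ : ∀ r : Site 2, ∫ ξ, exp ((∑ i, (r i : ℝ) * ξ i : ℝ) * I) ∂μ = ω.pairCorr S g 0 r)
    {ι : Type*} (T : Finset ι) (p : ι → Site 2) (q : ι → ℝ) :
    (∑ i ∈ T, q i) ^ 2 * braggWeight μ ![(0 : Fin 2 → ℝ)] ≤
      ∑ i ∈ T, ∑ j ∈ T, q i * q j * (ω.pairCorr S g (p i) (p j)).re := by
  have h := sq_sum_mul_braggWeight_zero_le μ hμ T p q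
  simp_rw [pairCorr_zero_sub S g hω] at h
  exact h

end Pair

/-! ## §3  The certificate side: the kernel pair word and the row ⇒ ceiling edges -/

section Word

open Matrix Literature.MathematicalPhysics.QuantumLattice Literature.Probability.LatticeModels
open Literature.MathematicalPhysics.QuantumLattice.HubbardWave0 ThermodynamicLimit
open scoped ComplexOrder

variable (S : Finset (Site 2)) (g : Site 2 → ℝ)

/-- **The kernel pair WORD** `Σ_{x∈B} Σ_{y∈B} Q x y • Γ(Φ_x)† Γ(Φ_y)` in the window `⋃_{x∈B} pairRegion S x`,
with exact rational taps `Q` (the objective of a kernel pair-ODLRO certificate; `Q ≡ 1` is `pairBoxWord`).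
[cite: Scalapino1995, §2 eq. (2.4)] -/
def pairKernelWord (B : Finset (Site 2)) (Q : Site 2 → Site 2 → ℚ) : FermionOp (B.biUnion (pairRegion S)) :=
  ∑ x ∈ B.attach, ∑ y ∈ B.attach, (((Q x y : ℚ) : ℝ) : ℂ) •
    (fermionEmbed (PolySite.incl (Finset.subset_biUnion_of_mem (pairRegion S) x.2)) (localPairAt S g x)ᴴ *
      fermionEmbed (PolySite.incl (Finset.subset_biUnion_of_mem (pairRegion S) y.2)) (localPairAt S g y))

/-- **Its expectation is the weighted pair sum**: `ω(pairKernelWord S g B Q) = Σ_{x,y∈B} Q x y · ω.pairCorr S g x y`. -/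
theorem expect_pairKernelWord (ω : InfVolFermionState 2) (B : Finset (Site 2)) (Q : Site 2 → Site 2 → ℚ) :
    ω.expect (B.biUnion (pairRegion S)) (pairKernelWord S g B Q) =
      ∑ x ∈ B, ∑ y ∈ B, (((Q x y : ℚ) : ℝ) : ℂ) * ω.pairCorr S g x y := by
  unfold pairKernelWord
  rw [map_sum]
  have hx : ∀ x ∈ B.attach, ω.expect (B.biUnion (pairRegion S)) (∑ y ∈ B.attach, (((Q x y : ℚ) : ℝ) : ℂ) •
      (fermionEmbed (PolySite.incl (Finset.subset_biUnion_of_mem (pairRegion S) x.2)) (localPairAt S g x)ᴴ *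
        fermionEmbed (PolySite.incl (Finset.subset_biUnion_of_mem (pairRegion S) y.2)) (localPairAt S g y))) =
      ∑ y ∈ B.attach, (((Q x y : ℚ) : ℝ) : ℂ) * ω.pairCorr S g x y := by
    intro x _
    rw [map_sum]
    refine Finset.sum_congr rfl fun y _ => ?_
    rw [map_smul, smul_eq_mul, ← ω.corr_eq_expect_of_subset]
    rfl
  rw [Finset.sum_congr rfl hx,
    Finset.sum_attach B (fun x => ∑ y ∈ B.attach, (((Q x y : ℚ) : ℝ) : ℂ) * ω.pairCorr S g x (y : Site 2))]
  exact Finset.sum_congr rfl fun x _ =>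
    Finset.sum_attach B (fun y => (((Q x y : ℚ) : ℝ) : ℂ) * ω.pairCorr S g x y)

/-- Real parts: `Re ω(pairKernelWord S g B Q) = Σ_{x,y∈B} Q x y · Re ω.pairCorr S g x y` (the taps are real). -/
theorem re_expect_pairKernelWord (ω : InfVolFermionState 2) (B : Finset (Site 2)) (Q : Site 2 → Site 2 → ℚ) :
    (ω.expect (B.biUnion (pairRegion S)) (pairKernelWord S g B Q)).re =
      ∑ x ∈ B, ∑ y ∈ B, ((Q x y : ℚ) : ℝ) * (ω.pairCorr S g x y).re := by
  rw [expect_pairKernelWord, Complex.re_sum]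
  refine Finset.sum_congr rfl fun x _ => ?_
  rw [Complex.re_sum]
  exact Finset.sum_congr rfl fun y _ => Complex.re_ofReal_mul _ _

/-- **Row ⇒ kernel pair-ODLRO ceiling (one energy row).** A thermodynamic-limit UPPER cell
`SquareTTPrimeCorrUpperRow tp U n u fu Λ_B (pairKernelWord S g B Q)` (energy cap `u`) with taps `Q` positive
semidefinite on `B` gives, for every torus limit `ω` of the class with `energyDensityTT' 1 tp U n ≤ u` and EVERY
finite measure `μ` representing its pair two-point function: `(Σ_{x,y∈B} Q x y) · braggWeight μ ![0] ≤ fu`. -/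
theorem kernel_mul_braggWeight_le_of_pairKernel_upperRow {tp U n : ℝ} {u fu : ℚ} {B : Finset (Site 2)}
    {Q : Site 2 → Site 2 → ℚ} (hQ : ∀ c : Site 2 → ℝ, 0 ≤ ∑ x ∈ B, ∑ y ∈ B, ((Q x y : ℚ) : ℝ) * c x * c y)
    (h : SquareTTPrimeCorrUpperRow tp U n u fu (B.biUnion (pairRegion S)) (pairKernelWord S g B Q))
    (ω : InfVolFermionState 2) (Ls : ℕ → ℕ) (ψ : ∀ L, Fock (Orb (FermionTorus 2 L)))
    (hLs : Tendsto Ls atTop atTop)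
    (hψ : ∀ j, IsGroundStateInSector (hubbardTorusTT' (Ls j) 1 tp U) (rectN n (Ls j)) 0 (ψ (Ls j)))
    (hψ1 : ∀ j, star (ψ (Ls j)) ⬝ᵥ ψ (Ls j) = 1) (hω : ω.IsTorusLimitOf ψ Ls)
    (hu : energyDensityTT' 1 tp U n ≤ ((u : ℚ) : ℝ))
    (μ : Measure (EuclideanSpace ℝ (Fin 2))) [IsFiniteMeasure μ]
    (hμ : ∀ r : Site 2, ∫ ξ, exp ((∑ i, (r i : ℝ) * ξ i : ℝ) * I) ∂μ = ω.pairCorr S g 0 r) :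
    (∑ x ∈ B, ∑ y ∈ B, ((Q x y : ℚ) : ℝ)) * braggWeight μ ![(0 : Fin 2 → ℝ)] ≤ ((fu : ℚ) : ℝ) := by
  have hrow := h ω Ls ψ hLs hψ hψ1 hω hu
  rw [re_expect_pairKernelWord] at hrow
  exact (kernel_mul_braggWeight_le_sum_re_pairCorr S g hω.isTranslationInvariant μ hμ B id
    (fun x y => ((Q x y : ℚ) : ℝ)) hQ).trans hrow

/-- Normalised: under the same hypotheses with `0 < Σ_{x,y∈B} Q x y`, `braggWeight μ ![0] ≤ fu / Σ Q`. -/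
theorem braggWeight_le_of_pairKernel_upperRow {tp U n : ℝ} {u fu : ℚ} {B : Finset (Site 2)}
    {Q : Site 2 → Site 2 → ℚ} (hQ : ∀ c : Site 2 → ℝ, 0 ≤ ∑ x ∈ B, ∑ y ∈ B, ((Q x y : ℚ) : ℝ) * c x * c y)
    (hQpos : 0 < ∑ x ∈ B, ∑ y ∈ B, ((Q x y : ℚ) : ℝ))
    (h : SquareTTPrimeCorrUpperRow tp U n u fu (B.biUnion (pairRegion S)) (pairKernelWord S g B Q))
    (ω : InfVolFermionState 2) (Ls : ℕ → ℕ) (ψ : ∀ L, Fock (Orb (FermionTorus 2 L)))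
    (hLs : Tendsto Ls atTop atTop)
    (hψ : ∀ j, IsGroundStateInSector (hubbardTorusTT' (Ls j) 1 tp U) (rectN n (Ls j)) 0 (ψ (Ls j)))
    (hψ1 : ∀ j, star (ψ (Ls j)) ⬝ᵥ ψ (Ls j) = 1) (hω : ω.IsTorusLimitOf ψ Ls)
    (hu : energyDensityTT' 1 tp U n ≤ ((u : ℚ) : ℝ))
    (μ : Measure (EuclideanSpace ℝ (Fin 2))) [IsFiniteMeasure μ]
    (hμ : ∀ r : Site 2, ∫ ξ, exp ((∑ i, (r i : ℝ) * ξ i : ℝ) * I) ∂μ = ω.pairCorr S g 0 r) :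
    braggWeight μ ![(0 : Fin 2 → ℝ)] ≤ ((fu : ℚ) : ℝ) / ∑ x ∈ B, ∑ y ∈ B, ((Q x y : ℚ) : ℝ) := by
  rw [le_div_iff₀ hQpos, mul_comm]
  exact kernel_mul_braggWeight_le_of_pairKernel_upperRow S g hQ h ω Ls ψ hLs hψ hψ1 hω hu μ hμ

/-- **M3′ d-wave form** (`U = 8`, `n = 7/8`, hopping `tp`): an `M3CorrUpperRow tp u fu Λ_B (pairKernelWord
({0} ∪ unitSteps) g_d B Q)` cell with positive-semidefinite taps `Q`, `0 < Σ Q`, and its energy cap discharged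
by a typed `M3EnergyUpperRow tp hi`, `hi ≤ u`, gives `braggWeight μ ![0] ≤ fu / Σ Q` for every torus-limit
ground state of the M3′ class and every measure representing `r ↦ ω.dWavePairCorr 0 r` — a certified
thermodynamic-limit ceiling on the `d`-wave pair ODLRO density. HONEST: a ceiling says nothing about the
presence of pairing. -/
theorem m3_dWavePair_braggWeight_le_of_kernel_upperRow {tp : ℝ} {u hi fu : ℚ} {B : Finset (Site 2)}
    {Q : Site 2 → Site 2 → ℚ} (hQ : ∀ c : Site 2 → ℝ, 0 ≤ ∑ x ∈ B, ∑ y ∈ B, ((Q x y : ℚ) : ℝ) * c x * c y)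
    (hQpos : 0 < ∑ x ∈ B, ∑ y ∈ B, ((Q x y : ℚ) : ℝ))
    (h : M3CorrUpperRow tp u fu (B.biUnion (pairRegion (insert 0 unitSteps)))
      (pairKernelWord (insert 0 unitSteps) dWaveFormFactor B Q))
    (hE : M3EnergyUpperRow tp hi) (hhi : hi ≤ u)
    (ω : InfVolFermionState 2) (Ls : ℕ → ℕ) (ψ : ∀ L, Fock (Orb (FermionTorus 2 L)))
    (hLs : Tendsto Ls atTop atTop)
    (hψ : ∀ j, IsGroundStateInSector (hubbardTorusTT' (Ls j) 1 tp 8) (rectN (7 / 8) (Ls j)) 0 (ψ (Ls j)))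
    (hψ1 : ∀ j, star (ψ (Ls j)) ⬝ᵥ ψ (Ls j) = 1) (hω : ω.IsTorusLimitOf ψ Ls)
    (μ : Measure (EuclideanSpace ℝ (Fin 2))) [IsFiniteMeasure μ]
    (hμ : ∀ r : Site 2, ∫ ξ, exp ((∑ i, (r i : ℝ) * ξ i : ℝ) * I) ∂μ = ω.dWavePairCorr 0 r) :
    braggWeight μ ![(0 : Fin 2 → ℝ)] ≤ ((fu : ℚ) : ℝ) / ∑ x ∈ B, ∑ y ∈ B, ((Q x y : ℚ) : ℝ) :=
  braggWeight_le_of_pairKernel_upperRow (insert 0 unitSteps) dWaveFormFactor hQ hQpos h ω Ls ψ hLs hψ hψ1 hω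
    ((show energyDensityTT' 1 tp 8 (7 / 8) ≤ ((hi : ℚ) : ℝ) from hE).trans (by exact_mod_cast hhi)) μ hμ

end Word

end Summit.Ventures.CertifiedManyBodySolver.Observables

end
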